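import Mathlib
import HarnessLib
import Literature.MathematicalPhysics.KineticTheory.LangevinChainGibbs

/-!
# Insertion identity toolbox, III: mollification of the weak equation; polynomial moments of the Gibbs state

Support file for stub `stub_insertionIdentity` (line `thermalise-then-cut-probe-insertion`, crux
`stmt-AtomisticToContinuum-11748`). (1) For a chain with `C¹` potentials, a finite measure `ν` and
`h, W ∈ L¹(ν)`, the weak equation `∫ (L_T f) h dν = −∫ f W dν` passes from `C^∞` to `C²` compactly
supported test functions: convolution with Mathlib's normed bump functions (`rOut = 1/(k+1)`),
`∂(ψ ⋆ φ) = ψ ⋆ ∂φ`, pointwise convergence, uniform bounds with supports in a fixed compact set,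
dominated convergence. (2) Continuous observables of polynomial growth in the energy are in `L¹`
and `L²` of the Gibbs state of the pinned chain (domination by `e^{H/2T}`). All [folklore].
No definitions.
-/

noncomputable section

open scoped ContDiff Topology ENNReal NNReal Convolution Pointwise
open MeasureTheory ProbabilityTheory Filter Set Function
open Literature.MathematicalPhysics.KineticTheory.HeatConduction

namespace Summit.AtomisticToContinuum.FouriersLaw.Cruxes.SuperadditiveResistance.InsertionToolbox

variable {L : ℕ}

/-! ### Mollification: the weak equation passes from `C^∞_c` to `C²_c` test functions

Convolution with the normed bump functions `ψ_k` (`rOut = 1/(k+1)`) of Mathlib: `ψ_k ⋆ φ` is smooth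
and compactly supported, its coordinate derivatives are `ψ_k ⋆ (∂φ)`, they converge pointwise and
stay uniformly bounded with supports in a fixed compact set; dominated convergence.
-/

section Mollify

variable {L : ℕ}

/-- Directional derivatives commute with mollification (`g ∈ C¹_c`). [folklore] -/
theorem fderiv_normed_convolution_apply (ψ : ContDiffBump (0 : PhaseSpace L)) {g : PhaseSpace L → ℝ}
    (hg : ContDiff ℝ 1 g) (hgc : HasCompactSupport g) (v x : PhaseSpace L) :
    fderiv ℝ (ψ.normed volume ⋆[ContinuousLinearMap.lsmul ℝ ℝ, volume] g) x v =
      (ψ.normed volume ⋆[ContinuousLinearMap.lsmul ℝ ℝ, volume] fun y => fderiv ℝ g y v) x := by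
  haveI := isAddHaarMeasure_volume_phaseSpace L
  have hf : LocallyIntegrable (ψ.normed volume) volume := ψ.continuous_normed.locallyIntegrable
  have h := hgc.hasFDerivAt_convolution_right (L := ContinuousLinearMap.lsmul ℝ ℝ) (μ := volume) hf hg x
  rw [h.fderiv]
  exact convolution_precompR_apply (L := ContinuousLinearMap.lsmul ℝ ℝ) hf (hgc.fderiv ℝ) (hg.continuous_fderiv one_ne_zero) x v

/-- `∂_{p_i}(ψ ⋆ φ) = ψ ⋆ ∂_{p_i}φ` for `φ ∈ C¹_c`. [folklore] -/
theorem partialP_normed_convolution (ψ : ContDiffBump (0 : PhaseSpace L)) {φ : PhaseSpace L → ℝ}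
    (hφ : ContDiff ℝ 1 φ) (hφc : HasCompactSupport φ) (i : Fin L) :
    partialP i (ψ.normed volume ⋆[ContinuousLinearMap.lsmul ℝ ℝ, volume] φ) =
      ψ.normed volume ⋆[ContinuousLinearMap.lsmul ℝ ℝ, volume] partialP i φ := by
  haveI := isAddHaarMeasure_volume_phaseSpace L
  have hd : Differentiable ℝ (ψ.normed volume ⋆[ContinuousLinearMap.lsmul ℝ ℝ, volume] φ) :=
    (hφc.contDiff_convolution_right (ContinuousLinearMap.lsmul ℝ ℝ) ψ.continuous_normed.locallyIntegrable hφ).differentiable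
      one_ne_zero
  rw [partialP_eq_fderiv hd, partialP_eq_fderiv (hφ.differentiable one_ne_zero)]
  funext x
  exact fderiv_normed_convolution_apply ψ hφ hφc _ x

/-- `∂_{q_i}(ψ ⋆ φ) = ψ ⋆ ∂_{q_i}φ` for `φ ∈ C¹_c`. [folklore] -/
theorem partialQ_normed_convolution (ψ : ContDiffBump (0 : PhaseSpace L)) {φ : PhaseSpace L → ℝ}
    (hφ : ContDiff ℝ 1 φ) (hφc : HasCompactSupport φ) (i : Fin L) :
    partialQ i (ψ.normed volume ⋆[ContinuousLinearMap.lsmul ℝ ℝ, volume] φ) =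
      ψ.normed volume ⋆[ContinuousLinearMap.lsmul ℝ ℝ, volume] partialQ i φ := by
  haveI := isAddHaarMeasure_volume_phaseSpace L
  have hd : Differentiable ℝ (ψ.normed volume ⋆[ContinuousLinearMap.lsmul ℝ ℝ, volume] φ) :=
    (hφc.contDiff_convolution_right (ContinuousLinearMap.lsmul ℝ ℝ) ψ.continuous_normed.locallyIntegrable hφ).differentiable
      one_ne_zero
  rw [partialQ_eq_fderiv hd, partialQ_eq_fderiv (hφ.differentiable one_ne_zero)]
  funext x
  exact fderiv_normed_convolution_apply ψ hφ hφc _ x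

/-- Mollification of a continuous compactly supported `g` is uniformly bounded (by `3 sup|g|`).
[folklore] -/
theorem exists_bound_normed_convolution {g : PhaseSpace L → ℝ} (hg : Continuous g)
    (hgc : HasCompactSupport g) :
    ∃ C : ℝ, 0 ≤ C ∧ ∀ (ψ : ContDiffBump (0 : PhaseSpace L)) (x : PhaseSpace L),
      |(ψ.normed volume ⋆[ContinuousLinearMap.lsmul ℝ ℝ, volume] g) x| ≤ C := by
  haveI := isAddHaarMeasure_volume_phaseSpace L
  obtain ⟨M, hM⟩ := hg.bounded_above_of_compact_support hgc
  have hM0 : 0 ≤ M := (norm_nonneg _).trans (hM 0)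
  refine ⟨3 * M, by positivity, fun ψ x => ?_⟩
  have h := ψ.dist_normed_convolution_le (μ := volume) (x₀ := x) (ε := 2 * M) hg.aestronglyMeasurable
    (fun y _ => by
      rw [dist_eq_norm]
      calc ‖g y - g x‖ ≤ ‖g y‖ + ‖g x‖ := norm_sub_le _ _
        _ ≤ M + M := add_le_add (hM y) (hM x)
        _ = 2 * M := by ring)
  rw [dist_eq_norm, Real.norm_eq_abs] at h
  have hx := hM x
  rw [Real.norm_eq_abs] at hx
  have := abs_sub_abs_le_abs_sub ((ψ.normed volume ⋆[ContinuousLinearMap.lsmul ℝ ℝ, volume] g) x) (g x)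
  linarith

/-- Mollification with `rOut ≤ 1` does not enlarge the support beyond the unit thickening.
[folklore] -/
theorem normed_convolution_eq_zero {g : PhaseSpace L → ℝ} (ψ : ContDiffBump (0 : PhaseSpace L))
    (hψ : ψ.rOut ≤ 1) {x : PhaseSpace L} (hx : x ∉ tsupport g + Metric.closedBall (0 : PhaseSpace L) 1) :
    (ψ.normed volume ⋆[ContinuousLinearMap.lsmul ℝ ℝ, volume] g) x = 0 := by
  by_contra h
  have hmem : x ∈ Function.support (ψ.normed volume ⋆[ContinuousLinearMap.lsmul ℝ ℝ, volume] g) := h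
  have hsub := support_convolution_subset_swap (ContinuousLinearMap.lsmul ℝ ℝ) (μ := (volume : Measure (PhaseSpace L)))
    (f := ψ.normed volume) (g := g) hmem
  rw [ψ.support_normed_eq] at hsub
  obtain ⟨a, ha, b, hb, rfl⟩ := hsub
  apply hx
  refine ⟨a, subset_tsupport _ ha, b, ?_, rfl⟩
  rw [Metric.mem_closedBall, dist_zero_right]
  rw [Metric.mem_ball, dist_zero_right] at hb
  linarith

/-- A continuous coefficient times a mollified `C_c` function is uniformly bounded (the coefficient
is bounded on the unit thickening of the support, outside which the mollification vanishes).
[folklore] -/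
theorem exists_bound_coeff_mul_normed_convolution {a g : PhaseSpace L → ℝ} (ha : Continuous a)
    (hg : Continuous g) (hgc : HasCompactSupport g) :
    ∃ C : ℝ, 0 ≤ C ∧ ∀ (ψ : ContDiffBump (0 : PhaseSpace L)), ψ.rOut ≤ 1 → ∀ x : PhaseSpace L,
      |a x * (ψ.normed volume ⋆[ContinuousLinearMap.lsmul ℝ ℝ, volume] g) x| ≤ C := by
  obtain ⟨Cg, hCg0, hCg⟩ := exists_bound_normed_convolution hg hgc
  have hK : IsCompact (tsupport g + Metric.closedBall (0 : PhaseSpace L) 1) :=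
    hgc.isCompact.add (isCompact_closedBall 0 1)
  obtain ⟨Ca, hCa⟩ := hK.exists_bound_of_continuousOn ha.continuousOn
  refine ⟨max Ca 0 * Cg, by positivity, fun ψ hψ x => ?_⟩
  by_cases hx : x ∈ tsupport g + Metric.closedBall (0 : PhaseSpace L) 1
  · rw [abs_mul]
    have h1 := hCa x hx
    rw [Real.norm_eq_abs] at h1
    exact mul_le_mul (h1.trans (le_max_left _ _)) (hCg ψ x) (abs_nonneg _) (by positivity)
  · rw [normed_convolution_eq_zero ψ hψ hx, mul_zero, abs_zero]
    positivity

/-- Pointwise convergence of mollifications of a continuous function along `rOut = 1/(k+1)`.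
[folklore] -/
theorem tendsto_normed_convolution (ψ : ℕ → ContDiffBump (0 : PhaseSpace L))
    (hψ : Tendsto (fun k => (ψ k).rOut) atTop (𝓝 0)) {g : PhaseSpace L → ℝ} (hg : Continuous g)
    (x : PhaseSpace L) :
    Tendsto (fun k => ((ψ k).normed volume ⋆[ContinuousLinearMap.lsmul ℝ ℝ, volume] g) x) atTop (𝓝 (g x)) := by
  haveI := isAddHaarMeasure_volume_phaseSpace L
  exact ContDiffBump.convolution_tendsto_right_of_continuous hψ hg x

/-- **Mollification of the weak equation.** For a chain with `C¹` potentials, a finite measure `ν`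
on phase space and `h, W ∈ L¹(ν)`: if `∫ (L_T f) h dν = −∫ f W dν` for all `C^∞` compactly
supported `f`, then also for all `C²` compactly supported `f`. [folklore] -/
theorem weak_tests_two_of_smooth (P : OscillatorChain) (hU : ContDiff ℝ 1 P.U) (hV : ContDiff ℝ 1 P.V)
    (L : ℕ) (T : ℝ) (ν : Measure (PhaseSpace L)) [IsFiniteMeasure ν] {h W : PhaseSpace L → ℝ}
    (hh : Integrable h ν) (hW : Integrable W ν)
    (hweak : ∀ f : PhaseSpace L → ℝ, ContDiff ℝ ∞ f → HasCompactSupport f →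
      ∫ x, P.generator L T T f x * h x ∂ν = -∫ x, f x * W x ∂ν) :
    ∀ f : PhaseSpace L → ℝ, ContDiff ℝ 2 f → HasCompactSupport f →
      ∫ x, P.generator L T T f x * h x ∂ν = -∫ x, f x * W x ∂ν := by
  haveI := isAddHaarMeasure_volume_phaseSpace L
  haveI : (volume : Measure (PhaseSpace L)).IsNegInvariant :=
    Measure.IsAddHaarMeasure.isNegInvariant_of_innerRegular volume
  intro φ hφ hφc
  -- the bumps
  let ψ : ℕ → ContDiffBump (0 : PhaseSpace L) := fun k =>
    { rIn := 1 / (2 * ((k : ℝ) + 1))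
      rOut := 1 / ((k : ℝ) + 1)
      rIn_pos := by positivity
      rIn_lt_rOut := by
        apply one_div_lt_one_div_of_lt (by positivity)
        linarith [show (0 : ℝ) ≤ k from Nat.cast_nonneg k] }
  have hψout : ∀ k, (ψ k).rOut = 1 / ((k : ℝ) + 1) := fun k => rfl
  have hψ1 : ∀ k, (ψ k).rOut ≤ 1 := fun k => by
    rw [hψout, div_le_one (by positivity)]; linarith [show (0 : ℝ) ≤ k from Nat.cast_nonneg k]
  have hψ0 : Tendsto (fun k => (ψ k).rOut) atTop (𝓝 0) := by
    simp only [hψout]; exact tendsto_one_div_add_atTop_nhds_zero_nat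
  -- the mollified test functions
  set m : ℕ → PhaseSpace L → ℝ := fun k => (ψ k).normed volume ⋆[ContinuousLinearMap.lsmul ℝ ℝ, volume] φ
    with hm
  have hφ1 : ContDiff ℝ 1 φ := hφ.of_le (by norm_num)
  have hφd : Differentiable ℝ φ := hφ.differentiable two_ne_zero
  have hmsmooth : ∀ k, ContDiff ℝ ∞ (m k) := fun k =>
    (ψ k).hasCompactSupport_normed.contDiff_convolution_left _ (ψ k).contDiff_normed
      hφ.continuous.locallyIntegrable
  have hmc : ∀ k, HasCompactSupport (m k) := fun k => (ψ k).hasCompactSupport_normed.convolution _ hφc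
  -- derivatives of the mollified test functions
  have hdP : ∀ i, ContDiff ℝ 1 (partialP i φ) := fun i => contDiff_partialP hφ (by norm_num) i
  have hdPc : ∀ i, HasCompactSupport (partialP i φ) := fun i => hasCompactSupport_partialP hφd hφc i
  have hmP : ∀ k i, partialP i (m k) =
      (ψ k).normed volume ⋆[ContinuousLinearMap.lsmul ℝ ℝ, volume] partialP i φ :=
    fun k i => partialP_normed_convolution (ψ k) hφ1 hφc i
  have hmQ : ∀ k i, partialQ i (m k) =
      (ψ k).normed volume ⋆[ContinuousLinearMap.lsmul ℝ ℝ, volume] partialQ i φ :=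
    fun k i => partialQ_normed_convolution (ψ k) hφ1 hφc i
  have hmPP : ∀ k i, partialP i (partialP i (m k)) =
      (ψ k).normed volume ⋆[ContinuousLinearMap.lsmul ℝ ℝ, volume] partialP i (partialP i φ) := by
    intro k i
    rw [hmP k i]
    exact partialP_normed_convolution (ψ k) (hdP i) (hdPc i) i
  -- pointwise convergence of the generator
  have hcP : ∀ i, Continuous (partialP i φ) := fun i => continuous_partialP hφ two_ne_zero i
  have hcQ : ∀ i, Continuous (partialQ i φ) := fun i => continuous_partialQ hφ two_ne_zero i
  have hcPP : ∀ i, Continuous (partialP i (partialP i φ)) := fun i =>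
    continuous_partialP (hdP i) one_ne_zero i
  have tP : ∀ i x, Tendsto (fun k => partialP i (m k) x) atTop (𝓝 (partialP i φ x)) := by
    intro i x; simp only [hmP]; exact tendsto_normed_convolution ψ hψ0 (hcP i) x
  have tQ : ∀ i x, Tendsto (fun k => partialQ i (m k) x) atTop (𝓝 (partialQ i φ x)) := by
    intro i x; simp only [hmQ]; exact tendsto_normed_convolution ψ hψ0 (hcQ i) x
  have tPP : ∀ i x, Tendsto (fun k => partialP i (partialP i (m k)) x) atTop
      (𝓝 (partialP i (partialP i φ) x)) := by
    intro i x; simp only [hmPP]; exact tendsto_normed_convolution ψ hψ0 (hcPP i) x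
  have tm : ∀ x, Tendsto (fun k => m k x) atTop (𝓝 (φ x)) := fun x =>
    tendsto_normed_convolution ψ hψ0 hφ.continuous x
  have tgen : ∀ x, Tendsto (fun k => P.generator L T T (m k) x) atTop (𝓝 (P.generator L T T φ x)) := by
    intro x
    simp only [OscillatorChain.generator]
    refine Tendsto.add (tendsto_finsetSum _ fun i _ => ?_)
      (Tendsto.const_mul _ (tendsto_finsetSum _ fun i _ => Tendsto.add ?_ ?_))
    · exact (tendsto_const_nhds.mul (tQ i x)).sub (tendsto_const_nhds.mul (tP i x))
    · split_ifs
      · exact (tendsto_const_nhds.mul (tPP i x)).sub (tendsto_const_nhds.mul (tP i x))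
      · exact tendsto_const_nhds
    · split_ifs
      · exact (tendsto_const_nhds.mul (tPP i x)).sub (tendsto_const_nhds.mul (tP i x))
      · exact tendsto_const_nhds
  -- uniform bounds
  have hH1 : ContDiff ℝ 1 (P.hamiltonian L) := P.contDiff_hamiltonian hU hV L
  choose C₁ hC₁0 hC₁ using fun i : Fin L =>
    exists_bound_coeff_mul_normed_convolution (((continuous_apply i).comp continuous_snd)) (hcQ i)
      (hasCompactSupport_partialQ hφd hφc i)
  choose C₂ hC₂0 hC₂ using fun i : Fin L =>
    exists_bound_coeff_mul_normed_convolution (P.continuous_partialQ_hamiltonian hH1 i) (hcP i) (hdPc i)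
  choose C₃ hC₃0 hC₃ using fun i : Fin L =>
    exists_bound_coeff_mul_normed_convolution (continuous_const (y := T)) (hcPP i)
      (hasCompactSupport_partialP (hdP i |>.differentiable one_ne_zero) (hdPc i) i)
  choose C₄ hC₄0 hC₄ using fun i : Fin L =>
    exists_bound_coeff_mul_normed_convolution (((continuous_apply i).comp continuous_snd)) (hcP i) (hdPc i)
  obtain ⟨C₀, hC₀0, hC₀⟩ := exists_bound_normed_convolution hφ.continuous hφc
  set B : ℝ := (∑ i, (C₁ i + C₂ i)) + |P.γ| * ∑ i, ((C₃ i + C₄ i) + (C₃ i + C₄ i)) with hB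
  have hbound : ∀ k x, |P.generator L T T (m k) x| ≤ B := by
    intro k x
    simp only [OscillatorChain.generator]
    refine (abs_add_le _ _).trans (add_le_add ?_ ?_)
    · refine (Finset.abs_sum_le_sum_abs _ _).trans (Finset.sum_le_sum fun i _ => ?_)
      refine (abs_sub _ _).trans (add_le_add ?_ ?_)
      · rw [hmQ]; exact hC₁ i (ψ k) (hψ1 k) x
      · rw [hmP]; exact hC₂ i (ψ k) (hψ1 k) x
    · rw [abs_mul]
      refine mul_le_mul_of_nonneg_left ?_ (abs_nonneg _)
      refine (Finset.abs_sum_le_sum_abs _ _).trans (Finset.sum_le_sum fun i _ => ?_)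
      refine (abs_add_le _ _).trans (add_le_add ?_ ?_)
      · split_ifs
        · refine (abs_sub _ _).trans (add_le_add ?_ ?_)
          · rw [hmPP]; exact hC₃ i (ψ k) (hψ1 k) x
          · rw [hmP]; exact hC₄ i (ψ k) (hψ1 k) x
        · rw [abs_zero]; exact add_nonneg (hC₃0 i) (hC₄0 i)
      · split_ifs
        · refine (abs_sub _ _).trans (add_le_add ?_ ?_)
          · rw [hmPP]; exact hC₃ i (ψ k) (hψ1 k) x
          · rw [hmP]; exact hC₄ i (ψ k) (hψ1 k) x
        · rw [abs_zero]; exact add_nonneg (hC₃0 i) (hC₄0 i)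
  -- dominated convergence, twice
  have hlim1 : Tendsto (fun k => ∫ x, P.generator L T T (m k) x * h x ∂ν) atTop
      (𝓝 (∫ x, P.generator L T T φ x * h x ∂ν)) := by
    refine tendsto_integral_of_dominated_convergence (fun x => B * |h x|) (fun k => ?_)
      (hh.abs.const_mul B) (fun k => ae_of_all _ fun x => ?_) (ae_of_all _ fun x => (tgen x).mul_const _)
    · exact ((P.continuous_generator hU hV L T T ((hmsmooth k).of_le (by norm_cast))).aestronglyMeasurable).mul hh.1
    · rw [Real.norm_eq_abs, abs_mul]
      exact mul_le_mul_of_nonneg_right (hbound k x) (abs_nonneg _)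
  have hlim2 : Tendsto (fun k => -∫ x, m k x * W x ∂ν) atTop (𝓝 (-∫ x, φ x * W x ∂ν)) := by
    refine (tendsto_integral_of_dominated_convergence (fun x => C₀ * |W x|) (fun k => ?_)
      (hW.abs.const_mul C₀) (fun k => ae_of_all _ fun x => ?_) (ae_of_all _ fun x => (tm x).mul_const _)).neg
    · exact ((hmsmooth k).continuous.aestronglyMeasurable).mul hW.1
    · rw [Real.norm_eq_abs, abs_mul]
      exact mul_le_mul_of_nonneg_right (hC₀ (ψ k) x) (abs_nonneg _)
  have heq : (fun k => ∫ x, P.generator L T T (m k) x * h x ∂ν) = fun k => -∫ x, m k x * W x ∂ν :=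
    funext fun k => hweak (m k) (hmsmooth k) (hmc k)
  rw [heq] at hlim1
  exact tendsto_nhds_unique hlim1 hlim2

end Mollify

/-! ### Moments: observables of polynomial growth in the energy are in every `L^p(μ_T)` -/

section Moments

variable {ω₂ lam β : ℝ}

/-- `(1 + H)^k ∈ L¹(μ_T)` for the pinned chain (`ω₂ > 0`, `lam, β ≥ 0`, `T > 0`): domination by
`e^{H/(2T)}`, which is `μ_T`-integrable. [folklore] -/
theorem pinnedChain_integrable_one_add_hamiltonian_pow (hω : 0 < ω₂) (hl : 0 ≤ lam) (hβ : 0 ≤ β)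
    (γ : ℝ) (L : ℕ) {T : ℝ} (hT : 0 < T) (k : ℕ) :
    Integrable (fun x : PhaseSpace L => (1 + (pinnedChain ω₂ lam β γ).hamiltonian L x) ^ k)
      ((pinnedChain ω₂ lam β γ).gibbsMeasure L T) := by
  set s : ℝ := 1 / (2 * T) with hs
  have hs0 : 0 < s := by positivity
  have hs1 : s < 1 / T := by
    rw [hs, div_lt_div_iff_of_pos_left one_pos (by positivity) hT]; linarith
  have hexp := pinnedChain_integrable_exp_mul_hamiltonian_gibbsMeasure hω hl hβ γ L hT hs1
  have hHc := pinnedChain_continuous_hamiltonian ω₂ lam β γ L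
  refine (hexp.const_mul ((k.factorial : ℝ) * Real.exp s / s ^ k)).mono'
    ((continuous_const.add hHc).pow k).aestronglyMeasurable (ae_of_all _ fun x => ?_)
  have hH0 : 0 ≤ (pinnedChain ω₂ lam β γ).hamiltonian L x :=
    pinnedChain_hamiltonian_nonneg hω.le hl hβ γ L x
  have h1 : 0 ≤ 1 + (pinnedChain ω₂ lam β γ).hamiltonian L x := by linarith
  rw [Real.norm_eq_abs, abs_of_nonneg (pow_nonneg h1 k)]
  have key := Real.pow_div_factorial_le_exp (s * (1 + (pinnedChain ω₂ lam β γ).hamiltonian L x))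
    (by positivity) k
  rw [mul_pow, mul_add, mul_one, Real.exp_add] at key
  have hk : (0 : ℝ) < k.factorial := by exact_mod_cast k.factorial_pos
  have hsk : 0 < s ^ k := pow_pos hs0 k
  rw [div_le_iff₀ hk] at key
  calc (1 + (pinnedChain ω₂ lam β γ).hamiltonian L x) ^ k
      = (s ^ k * (1 + (pinnedChain ω₂ lam β γ).hamiltonian L x) ^ k) / s ^ k := by
        field_simp
    _ ≤ (Real.exp s * Real.exp (s * (pinnedChain ω₂ lam β γ).hamiltonian L x) * k.factorial) / s ^ k :=
        div_le_div_of_nonneg_right key hsk.le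
    _ = (k.factorial : ℝ) * Real.exp s / s ^ k *
        Real.exp (s * (pinnedChain ω₂ lam β γ).hamiltonian L x) := by
        field_simp

/-- **Observables of polynomial growth in the energy are `μ_T`-integrable**: a continuous `g` with
`|g| ≤ C (1 + H)^k` is in `L¹(μ_T)`. [folklore] -/
theorem pinnedChain_integrable_of_abs_le (hω : 0 < ω₂) (hl : 0 ≤ lam) (hβ : 0 ≤ β) (γ : ℝ)
    (L : ℕ) {T : ℝ} (hT : 0 < T) {g : PhaseSpace L → ℝ} (hg : Continuous g) {C : ℝ} {k : ℕ}
    (hle : ∀ x, |g x| ≤ C * (1 + (pinnedChain ω₂ lam β γ).hamiltonian L x) ^ k) :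
    Integrable g ((pinnedChain ω₂ lam β γ).gibbsMeasure L T) :=
  ((pinnedChain_integrable_one_add_hamiltonian_pow hω hl hβ γ L hT k).const_mul C).mono'
    hg.aestronglyMeasurable (ae_of_all _ fun x => by rw [Real.norm_eq_abs]; exact hle x)

/-- **… and in `L²(μ_T)`**: a continuous `g` with `|g| ≤ C (1 + H)^k` is in `L²(μ_T)`. [folklore] -/
theorem pinnedChain_memLp_two_of_abs_le (hω : 0 < ω₂) (hl : 0 ≤ lam) (hβ : 0 ≤ β) (γ : ℝ)
    (L : ℕ) {T : ℝ} (hT : 0 < T) {g : PhaseSpace L → ℝ} (hg : Continuous g) {C : ℝ} {k : ℕ}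
    (hle : ∀ x, |g x| ≤ C * (1 + (pinnedChain ω₂ lam β γ).hamiltonian L x) ^ k) :
    MemLp g 2 ((pinnedChain ω₂ lam β γ).gibbsMeasure L T) := by
  rw [memLp_two_iff_integrable_sq hg.aestronglyMeasurable]
  refine pinnedChain_integrable_of_abs_le hω hl hβ γ L hT (hg.pow 2) (C := C ^ 2) (k := 2 * k)
    fun x => ?_
  have h1 : 0 ≤ 1 + (pinnedChain ω₂ lam β γ).hamiltonian L x := by
    linarith [pinnedChain_hamiltonian_nonneg hω.le hl hβ γ L x]
  have h := hle x
  have hC : 0 ≤ C * (1 + (pinnedChain ω₂ lam β γ).hamiltonian L x) ^ k := (abs_nonneg _).trans h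
  rw [abs_of_nonneg (sq_nonneg _), ← sq_abs, show C ^ 2 *
    (1 + (pinnedChain ω₂ lam β γ).hamiltonian L x) ^ (2 * k) =
    (C * (1 + (pinnedChain ω₂ lam β γ).hamiltonian L x) ^ k) ^ 2 by ring]
  exact pow_le_pow_left₀ (abs_nonneg _) h 2

end Moments

/-- Registered helper stub of this support file: the weak equation of the chain passes from `C^∞_c` to `C²_c` test functions. [folklore] -/
theorem helper_insertionMollify : ∀ (P : OscillatorChain), ContDiff ℝ 1 P.U → ContDiff ℝ 1 P.V → ∀ (L : ℕ) (T : ℝ) (ν : Measure (PhaseSpace L)) [IsFiniteMeasure ν] {h W : PhaseSpace L → ℝ}, Integrable h ν → Integrable W ν → (∀ f : PhaseSpace L → ℝ, ContDiff ℝ ∞ f → HasCompactSupport f → ∫ x, P.generator L T T f x * h x ∂ν = -∫ x, f x * W x ∂ν) → ∀ f : PhaseSpace L → ℝ, ContDiff ℝ 2 f → HasCompactSupport f → ∫ x, P.generator L T T f x * h x ∂ν = -∫ x, f x * W x ∂ν := by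
  intro P hU hV L T ν _ h W hh hW hweak
  exact weak_tests_two_of_smooth P hU hV L T ν hh hW hweak

end Summit.AtomisticToContinuum.FouriersLaw.Cruxes.SuperadditiveResistance.InsertionToolbox

end
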